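import Summits.CriticalPhenomena.PercolationContinuityZ3.Theorems.FK.PressureVanHoveCovering
import Summits.CriticalPhenomena.PercolationContinuityZ3.Theorems.FK.MagnetizationChernoffBounds
import Literature.Probability.LatticeModels.IsingAutomorphismCovariance
import HarnessLib

/-!
# BLOCK TILING OF THE BOXES `Λ_N` BY TRANSLATES OF `Λ_n` AND TRANSLATION COVARIANCE OF TOTAL-SPIN EVENTS
# (the geometry behind the sub-additive large-deviation lower bound; Lanford 1973 §A4, Friedli–Velenik 2017 Thm. 3.6)

Claimed R42 (8)(c) in the cell INBOX at 2026-08-29T11:54:27Z by fkp-10a gen 360 (NEW CLAIM #1 of the gen), addressed to the lane under (ι) (coordinator fk-4 gen 295 CLOSED l.8907 11:26:11Z 2026-08-29; «(ι) RESUMES») and to the next seated fk-4 generation (ruling R182 requested); lineage row FO-10a-g360 (self-suggested), package g360-plateau, label PL-B.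
Helper file of the `fk-continuity` build cell (bschramm lane; `--supports stmt-CriticalPhenomena-4575`; fkp-10a gen 360,
package g360-plateau, label PL-B); builds on p205010 (kernel theorem, internal audit signed; external expert review
pending). No definitions, no named facts, no sorries; standard axioms.
UNCONDITIONAL (`ℤ^d`, every `d`; nearest-neighbour Ising model at every real `β`, `h` for
the covariance statements; pure combinatorics otherwise).
Scope: lattice combinatorics of tilings and the translation covariance of total-spin events; no probabilistic limit
statement beyond `|∂ᵉˣΛ_N| m^d/|Λ_N| → 0`; nothing percolation-bearing.

Notation: `C_m = {0,…,m−1}^d` (`halfOpenBox d m`), tiles `mv + C_m` (`v ∈ ℤ^d`), `Λ_N = {−N,…,N}^d`,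
`M_Λ(σ) = Σ_{x∈Λ} σ_x`, `∂ᵉˣΛ` = `outerBoundary`.

* `sum_spinAt_congr_of_eqOn`, `abs_sum_spinAt_sub_lt_iff_of_eqOn` — `M_Λ` and its windows are determined by the
  spins in `Λ`;
* `preimage_configRelabel_sum_spinAt_mem`, **`isingMeasure_fixed_real_sum_spinAt_map_shift`** — TRANSLATION
  COVARIANCE of total-spin events: `μ^{ζ}_{Λ+v;β,h}{M_{Λ+v} ∈ S} = μ^{ζ(·+v)}_{Λ;β,h}{M_Λ ∈ S}`
  (`isingMeasure_fixed_map_relabel` for the translation automorphism `zdShiftIso v`); hence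
  `forall_fixed_le_real_sum_spinAt_map_shift` / `forall_fixed_real_sum_spinAt_map_shift_le`: a bound valid for
  EVERY fixed boundary condition transfers to every translate;
* `box_eq_map_shift_smul_add` — the tile `(2n+1)v + C_{2n+1}` is the translate of `Λ_n` by `(2n+1)v + (n,…,n)`;
* `exists_tiles_subset` — **TILING**: for `m ≥ 1` and every finite `Λ ⊆ ℤ^d` there is a finite set `A` of tile
  indices with `mv + C_m ⊆ Λ` (`v ∈ A`), `|A| m^d ≤ |Λ| ≤ |A| m^d + |∂ᵉˣΛ| m^d` (`card_sdiff_biUnion_tiles_le`);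
* `sum_spinAt_eq_sum_tiles_add`, `abs_sum_spinAt_sub_sum_tiles_le`, **`abs_sum_spinAt_sub_le_of_tiles`** — on the
  event "every tile `v ∈ A` has `|M_{mv+C_m} − t_v m^d| < δ m^d`" one has
  `|M_Λ − (Σ_{v∈A} t_v) m^d| ≤ δ |A| m^d + (|Λ| − |A| m^d)`;
* `exists_nat_abs_sub_le` / `exists_signs_abs_sum_sub_le` — choice of the phases: for `|a| ≤ m`, `m ≥ 0` and any
  finite index set `A` there are targets `t_v ∈ {m, −m}` with `|Σ_{v∈A} t_v − a|A|| ≤ 2m`;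
* `tendsto_card_outerBoundary_box_div`, `tendsto_card_outerBoundary_box_mul_div` — `|∂ᵉˣΛ_N| m^d/|Λ_N| → 0`.

## References

* O. E. Lanford, *Entropy and equilibrium states in classical statistical mechanics*, LNP 20 (1973), §A4.
  [Lanford1973]
* S. Friedli, Y. Velenik, *Statistical Mechanics of Lattice Systems*, CUP (2017), proof of Thm. 3.6, eqs. (3.4)–(3.5)
  (tiling by translates of a cube, thin remainder), Exercise 6.21 (lattice symmetries). [FriedliVelenik2017]
* H. Föllmer, S. Orey, Ann. Probab. 16 (1988), §2. [FollmerOrey1988]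
-/

noncomputable section

namespace Summit.CriticalPhenomena.PercolationContinuityZ3.Theorems.FK

namespace IsingLargeDeviations

open MeasureTheory Filter Topology Finset Set
open Literature.Probability.LatticeModels Literature.Probability.Percolation

variable {d : ℕ}

/-! ### Total-spin events are determined by the spins of their volume -/

/-- `M_Λ(σ₁) = M_Λ(σ₂)` when `σ₁ = σ₂` on `Λ`. [folklore] -/
theorem sum_spinAt_congr_of_eqOn {V : Type*} {Λ : Finset V} {σ₁ σ₂ : SpinConfig V} (h : ∀ x ∈ Λ, σ₁ x = σ₂ x) :
    ∑ x ∈ Λ, spinAt x σ₁ = ∑ x ∈ Λ, spinAt x σ₂ :=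
  Finset.sum_congr rfl fun x hx ↦ by simp only [spinAt, h x hx]

/-- The window `{|M_Λ − a| < δ}` is determined by the spins in `Λ`. [folklore] -/
theorem abs_sum_spinAt_sub_lt_iff_of_eqOn {V : Type*} {Λ : Finset V} (a δ : ℝ) (σ₁ σ₂ : SpinConfig V)
    (h : ∀ x ∈ Λ, σ₁ x = σ₂ x) :
    σ₁ ∈ {σ : SpinConfig V | |∑ x ∈ Λ, spinAt x σ - a| < δ} ↔ σ₂ ∈ {σ : SpinConfig V | |∑ x ∈ Λ, spinAt x σ - a| < δ} := by
  simp only [mem_setOf_eq, sum_spinAt_congr_of_eqOn h]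

/-! ### Translation covariance of total-spin events -/

/-- The pull-back of `{M_{Λ+v} ∈ S}` under the translation of configurations is `{M_Λ ∈ S}`.
[cite: FriedliVelenik2017, Exercise 6.21] -/
theorem preimage_configRelabel_sum_spinAt_mem (v : Site d) (Λ : Finset (Site d)) (S : Set ℝ) :
    configRelabel (Site.shift v) ⁻¹' {σ | ∑ x ∈ Λ.map (Site.shift v).toEmbedding, spinAt x σ ∈ S} =
      {σ | ∑ x ∈ Λ, spinAt x σ ∈ S} := by
  ext σ
  simp only [Set.mem_preimage, mem_setOf_eq, Finset.sum_map, Equiv.coe_toEmbedding, spinAt_apply_configRelabel]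

/-- **TRANSLATION COVARIANCE OF TOTAL-SPIN EVENTS**: `μ^{ζ}_{Λ+v;β,h}{M_{Λ+v} ∈ S} = μ^{R_v⁻¹ζ}_{Λ;β,h}{M_Λ ∈ S}`
(`R_v σ = σ(· − v)`). [cite: FriedliVelenik2017, Exercise 6.21; GeorgiiHiguchi2000, §2 p. 3] -/
theorem isingMeasure_fixed_real_sum_spinAt_map_shift (v : Site d) (Λ : Finset (Site d)) (β h : ℝ)
    (ζ : SpinConfig (Site d)) {S : Set ℝ} (hS : MeasurableSet S) :
    (isingMeasure (zdGraph d) (Λ.map (Site.shift v).toEmbedding) β h (.fixed ζ)).real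
        {σ | ∑ x ∈ Λ.map (Site.shift v).toEmbedding, spinAt x σ ∈ S} =
      (isingMeasure (zdGraph d) Λ β h (.fixed ((configRelabel (Site.shift v)).symm ζ))).real
        {σ | ∑ x ∈ Λ, spinAt x σ ∈ S} := by
  set R := configRelabel (Site.shift v : Site d ≃ Site d) with hR
  set η := R.symm ζ with hη
  have hRη : R η = ζ := R.apply_symm_apply ζ
  have h1 : (isingMeasure (zdGraph d) Λ β h (.fixed η)).map R =
      isingMeasure (zdGraph d) (Λ.map (Site.shift v).toEmbedding) β h (.fixed ζ) := by
    have := isingMeasure_fixed_map_relabel (zdGraph d) (zdShiftIso v) Λ β h η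
    rw [← hRη]
    exact this
  have hE : MeasurableSet {σ : SpinConfig (Site d) | ∑ x ∈ Λ.map (Site.shift v).toEmbedding, spinAt x σ ∈ S} :=
    measurable_sum_spinAt _ hS
  rw [← h1, map_measureReal_apply R.measurable hE, preimage_configRelabel_sum_spinAt_mem]

/-- A LOWER bound on `μ^{η}_{Λ;β,h}{M_Λ ∈ S}` valid for every fixed boundary condition transfers to every translate
`Λ + v`. [cite: FriedliVelenik2017, Exercise 6.21] -/
theorem forall_fixed_le_real_sum_spinAt_map_shift (v : Site d) (Λ : Finset (Site d)) (β h : ℝ) {S : Set ℝ}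
    (hS : MeasurableSet S) {p : ℝ}
    (hp : ∀ η : SpinConfig (Site d), p ≤ (isingMeasure (zdGraph d) Λ β h (.fixed η)).real {σ | ∑ x ∈ Λ, spinAt x σ ∈ S})
    (ζ : SpinConfig (Site d)) :
    p ≤ (isingMeasure (zdGraph d) (Λ.map (Site.shift v).toEmbedding) β h (.fixed ζ)).real
        {σ | ∑ x ∈ Λ.map (Site.shift v).toEmbedding, spinAt x σ ∈ S} := by
  rw [isingMeasure_fixed_real_sum_spinAt_map_shift v Λ β h ζ hS]
  exact hp _

/-- An UPPER bound on `μ^{η}_{Λ;β,h}{M_Λ ∈ S}` valid for every fixed boundary condition transfers to every translate.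
[cite: FriedliVelenik2017, Exercise 6.21] -/
theorem forall_fixed_real_sum_spinAt_map_shift_le (v : Site d) (Λ : Finset (Site d)) (β h : ℝ) {S : Set ℝ}
    (hS : MeasurableSet S) {P : ℝ}
    (hP : ∀ η : SpinConfig (Site d), (isingMeasure (zdGraph d) Λ β h (.fixed η)).real {σ | ∑ x ∈ Λ, spinAt x σ ∈ S} ≤ P)
    (ζ : SpinConfig (Site d)) :
    (isingMeasure (zdGraph d) (Λ.map (Site.shift v).toEmbedding) β h (.fixed ζ)).real
        {σ | ∑ x ∈ Λ.map (Site.shift v).toEmbedding, spinAt x σ ∈ S} ≤ P := by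
  rw [isingMeasure_fixed_real_sum_spinAt_map_shift v Λ β h ζ hS]
  exact hP _

/-! ### The tiles `(2n+1)v + C_{2n+1}` are translates of `Λ_n` -/

/-- **`(2n+1)v + C_{2n+1} = Λ_n + ((2n+1)v + (n,…,n))`**: the tiles of side `2n+1` are translates of the centred box
`Λ_n`. [cite: FriedliVelenik2017, §3.2.1] -/
theorem box_eq_map_shift_smul_add (n : ℕ) (v : Site d) :
    (halfOpenBox d (2 * n + 1)).map (Site.shift (((2 * n + 1 : ℕ) : ℤ) • v)).toEmbedding =
      (box d n).map (Site.shift (fun i => (n : ℤ) + ((2 * n + 1 : ℕ) : ℤ) * v i)).toEmbedding := by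
  ext x
  rw [mem_map_shift_halfOpenBox, Finset.mem_map_equiv, Site.shift_symm_apply, mem_box]
  simp only [Pi.smul_apply, smul_eq_mul, Pi.sub_apply]
  refine forall_congr' fun i ↦ ?_
  push_cast
  constructor <;> rintro ⟨h1, h2⟩ <;> constructor <;> linarith

/-! ### Tiling a finite volume by the tiles it contains -/

/-- **TILING**: for `m ≥ 1` and a finite `Λ ⊆ ℤ^d` there is a finite set `A` of tile indices such that every tile
`mv + C_m` (`v ∈ A`) lies in `Λ` and `|A| m^d ≤ |Λ| ≤ |A| m^d + |∂ᵉˣΛ| m^d` (the points of `Λ` not covered by a tile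
inside `Λ` lie in tiles meeting `∂ᵉˣΛ`). [cite: FriedliVelenik2017, Thm. 3.6 (proof), eq. (3.5); Lanford1973, §A4] -/
theorem exists_tiles_subset {m : ℕ} (hm : 0 < m) (Λ : Finset (Site d)) :
    ∃ A : Finset (Site d), (∀ v ∈ A, (halfOpenBox d m).map (Site.shift ((m : ℤ) • v)).toEmbedding ⊆ Λ) ∧
      #A * m ^ d ≤ #Λ ∧ #Λ ≤ #A * m ^ d + #(outerBoundary (zdGraph d) Λ) * m ^ d := by
  classical
  set T : Site d → Finset (Site d) := fun v => (halfOpenBox d m).map (Site.shift ((m : ℤ) • v)).toEmbedding with hT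
  set A := (Λ.image fun x : Site d => fun i => x i / (m : ℤ)).filter fun v => T v ⊆ Λ with hA
  have hAsub : ∀ v ∈ A, T v ⊆ Λ := fun v hv => (Finset.mem_filter.1 hv).2
  have hU : A.biUnion T ⊆ Λ := Finset.biUnion_subset.2 hAsub
  have hcardU : #(A.biUnion T) = #A * m ^ d := card_biUnion_map_shift_smul_halfOpenBox hm A
  have hsplit : #(Λ \ A.biUnion T) + #(A.biUnion T) = #Λ := Finset.card_sdiff_add_card_eq_card hU
  have hrem : #(Λ \ A.biUnion T) ≤ #(outerBoundary (zdGraph d) Λ) * m ^ d := card_sdiff_biUnion_tiles_le hm Λ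
  refine ⟨A, hAsub, ?_, ?_⟩ <;> omega

/-- The tiles indexed by distinct `v` are disjoint, so the total spin of their union is the sum of the tile spins.
[cite: FriedliVelenik2017, Thm. 3.6 (proof)] -/
theorem sum_spinAt_biUnion_tiles {m : ℕ} (hm : 0 < m) (A : Finset (Site d)) (σ : SpinConfig (Site d)) :
    ∑ x ∈ A.biUnion (fun v => (halfOpenBox d m).map (Site.shift ((m : ℤ) • v)).toEmbedding), spinAt x σ =
      ∑ v ∈ A, ∑ x ∈ (halfOpenBox d m).map (Site.shift ((m : ℤ) • v)).toEmbedding, spinAt x σ :=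
  Finset.sum_biUnion fun _ _ _ _ hvw => disjoint_map_shift_halfOpenBox hm hvw

/-- **`M_Λ = Σ_{v∈A} M_{mv+C_m} + M_{remainder}`** for tiles inside `Λ`. [cite: Lanford1973, §A4] -/
theorem sum_spinAt_eq_sum_tiles_add {m : ℕ} (hm : 0 < m) {Λ : Finset (Site d)} {A : Finset (Site d)}
    (hA : ∀ v ∈ A, (halfOpenBox d m).map (Site.shift ((m : ℤ) • v)).toEmbedding ⊆ Λ) (σ : SpinConfig (Site d)) :
    ∑ x ∈ Λ, spinAt x σ =
      (∑ v ∈ A, ∑ x ∈ (halfOpenBox d m).map (Site.shift ((m : ℤ) • v)).toEmbedding, spinAt x σ) +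
        ∑ x ∈ Λ \ A.biUnion (fun v => (halfOpenBox d m).map (Site.shift ((m : ℤ) • v)).toEmbedding), spinAt x σ := by
  rw [← sum_spinAt_biUnion_tiles hm, add_comm, Finset.sum_sdiff (Finset.biUnion_subset.2 hA)]

/-- **The remainder carries at most `|Λ| − |A| m^d` of the total spin**: `|M_Λ − Σ_{v∈A} M_{mv+C_m}| ≤ |Λ| − |A| m^d`.
[cite: Lanford1973, §A4; FriedliVelenik2017, Thm. 3.6 (proof)] -/
theorem abs_sum_spinAt_sub_sum_tiles_le {m : ℕ} (hm : 0 < m) {Λ : Finset (Site d)} {A : Finset (Site d)}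
    (hA : ∀ v ∈ A, (halfOpenBox d m).map (Site.shift ((m : ℤ) • v)).toEmbedding ⊆ Λ) (σ : SpinConfig (Site d)) :
    |∑ x ∈ Λ, spinAt x σ - ∑ v ∈ A, ∑ x ∈ (halfOpenBox d m).map (Site.shift ((m : ℤ) • v)).toEmbedding, spinAt x σ| ≤
      (#Λ : ℝ) - #A * m ^ d := by
  classical
  have hU : A.biUnion (fun v => (halfOpenBox d m).map (Site.shift ((m : ℤ) • v)).toEmbedding) ⊆ Λ :=
    Finset.biUnion_subset.2 hA
  have hcard : (#(Λ \ A.biUnion (fun v => (halfOpenBox d m).map (Site.shift ((m : ℤ) • v)).toEmbedding)) : ℝ) =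
      (#Λ : ℝ) - #A * m ^ d := by
    have h1 := Finset.card_sdiff_add_card_eq_card hU
    rw [card_biUnion_map_shift_smul_halfOpenBox hm A] at h1
    have h2 : (#(Λ \ A.biUnion (fun v => (halfOpenBox d m).map (Site.shift ((m : ℤ) • v)).toEmbedding)) : ℝ) +
        #A * m ^ d = #Λ := by exact_mod_cast h1
    linarith
  rw [sum_spinAt_eq_sum_tiles_add hm hA σ, add_sub_cancel_left, ← hcard]
  exact abs_sum_spinAt_le σ _

/-- **ON THE BLOCK-WINDOW EVENT**: if every tile `v ∈ A` (inside `Λ`) has `|M_{mv+C_m} − t_v m^d| < δ m^d`, then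
`|M_Λ − (Σ_{v∈A} t_v) m^d| ≤ δ |A| m^d + (|Λ| − |A| m^d)`. [cite: Lanford1973, §A4] -/
theorem abs_sum_spinAt_sub_le_of_tiles {m : ℕ} (hm : 0 < m) {Λ : Finset (Site d)} {A : Finset (Site d)}
    (hA : ∀ v ∈ A, (halfOpenBox d m).map (Site.shift ((m : ℤ) • v)).toEmbedding ⊆ Λ) (t : Site d → ℝ) {δ : ℝ}
    (σ : SpinConfig (Site d))
    (hW : ∀ v ∈ A, |∑ x ∈ (halfOpenBox d m).map (Site.shift ((m : ℤ) • v)).toEmbedding, spinAt x σ - t v * m ^ d| <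
      δ * m ^ d) :
    |∑ x ∈ Λ, spinAt x σ - (∑ v ∈ A, t v) * m ^ d| ≤ δ * #A * m ^ d + ((#Λ : ℝ) - #A * m ^ d) := by
  have h1 := abs_sum_spinAt_sub_sum_tiles_le hm hA σ
  have h2 : |∑ v ∈ A, ∑ x ∈ (halfOpenBox d m).map (Site.shift ((m : ℤ) • v)).toEmbedding, spinAt x σ -
      (∑ v ∈ A, t v) * m ^ d| ≤ δ * #A * m ^ d := by
    rw [Finset.sum_mul, ← Finset.sum_sub_distrib]
    refine (Finset.abs_sum_le_sum_abs _ _).trans ?_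
    calc ∑ v ∈ A, |∑ x ∈ (halfOpenBox d m).map (Site.shift ((m : ℤ) • v)).toEmbedding, spinAt x σ - t v * m ^ d|
        ≤ ∑ v ∈ A, δ * m ^ d := Finset.sum_le_sum fun v hv => (hW v hv).le
      _ = δ * #A * m ^ d := by rw [Finset.sum_const, nsmul_eq_mul]; ring
  calc |∑ x ∈ Λ, spinAt x σ - (∑ v ∈ A, t v) * m ^ d|
      = |(∑ x ∈ Λ, spinAt x σ - ∑ v ∈ A, ∑ x ∈ (halfOpenBox d m).map (Site.shift ((m : ℤ) • v)).toEmbedding,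
            spinAt x σ) +
          (∑ v ∈ A, ∑ x ∈ (halfOpenBox d m).map (Site.shift ((m : ℤ) • v)).toEmbedding, spinAt x σ -
            (∑ v ∈ A, t v) * m ^ d)| := by congr 1; ring
    _ ≤ _ := (abs_add_le _ _).trans (by linarith)

/-! ### Choosing the phases of the tiles -/

/-- For `0 ≤ m`, `|a| ≤ m` and `K ∈ ℕ` there is `k ≤ K` with `|m(2k − K) − aK| ≤ 2m` (the lattice `{m(2k−K)}` has
mesh `2m` and spans `[−mK, mK] ∋ aK`). [folklore] -/
theorem exists_nat_abs_sub_le (K : ℕ) {m a : ℝ} (hm : 0 ≤ m) (ha : |a| ≤ m) :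
    ∃ k : ℕ, k ≤ K ∧ |m * (2 * k - K) - a * K| ≤ 2 * m := by
  rcases hm.eq_or_lt with rfl | hm'
  · have ha0 : a = 0 := abs_nonpos_iff.1 ha
    exact ⟨0, Nat.zero_le _, by simp [ha0]⟩
  · have hK : (0 : ℝ) ≤ K := Nat.cast_nonneg K
    set x : ℝ := K * (m + a) / (2 * m) with hx
    have hx0 : 0 ≤ x := div_nonneg (mul_nonneg hK (by linarith [neg_abs_le a, abs_le.1 ha])) (by linarith)
    have hxK : x ≤ K := by
      rw [hx, div_le_iff₀ (by linarith)]
      nlinarith [le_abs_self a]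
    refine ⟨⌊x⌋₊, ?_, ?_⟩
    · exact_mod_cast (Nat.floor_le hx0).trans hxK
    · have h1 : (⌊x⌋₊ : ℝ) ≤ x := Nat.floor_le hx0
      have h2 : x < ⌊x⌋₊ + 1 := Nat.lt_floor_add_one x
      have hx2 : 2 * m * x = K * (m + a) := by rw [hx]; field_simp
      rw [abs_le]
      constructor <;> nlinarith

/-- **CHOICE OF THE PHASES**: for `0 ≤ m`, `|a| ≤ m` and a finite index set `A` there are targets `t_v ∈ {m, −m}`
(`v ∈ A`) with `|Σ_{v∈A} t_v − a|A|| ≤ 2m`. [folklore] -/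
theorem exists_signs_abs_sum_sub_le {α : Type*} [DecidableEq α] (A : Finset α) {m a : ℝ} (hm : 0 ≤ m)
    (ha : |a| ≤ m) :
    ∃ t : α → ℝ, (∀ v, t v = m ∨ t v = -m) ∧ |∑ v ∈ A, t v - a * #A| ≤ 2 * m := by
  obtain ⟨k, hk, hkm⟩ := exists_nat_abs_sub_le #A hm ha
  obtain ⟨B, hBA, hBk⟩ := Finset.exists_subset_card_eq hk
  refine ⟨fun v => if v ∈ B then m else -m, fun v => by by_cases hv : v ∈ B <;> simp [hv], ?_⟩
  have hsum : ∑ v ∈ A, (if v ∈ B then m else -m) = m * (2 * k - #A) := by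
    rw [Finset.sum_ite, Finset.sum_const, Finset.sum_const, nsmul_eq_mul, nsmul_eq_mul, Finset.filter_mem_eq_inter,
      Finset.inter_eq_right.2 hBA, hBk, Finset.filter_not, Finset.filter_mem_eq_inter, Finset.inter_eq_right.2 hBA]
    have h1 : (#(A \ B) : ℝ) = #A - k := by
      rw [Finset.card_sdiff_of_subset hBA, Nat.cast_sub (hBk ▸ Finset.card_le_card hBA), hBk]
    rw [h1]
    ring
  rw [hsum]
  exact hkm

/-! ### The boxes `Λ_N`: the remainder of the tiling is negligible -/

/-- `|∂ᵉˣΛ_N| / |Λ_N| → 0` (`|∂ᵉˣΛ_N| ≤ (2N+3)^d − (2N+1)^d`). [cite: FriedliVelenik2017, §3.2.1 Exercise 3.1] -/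
theorem tendsto_card_outerBoundary_box_div (d : ℕ) :
    Tendsto (fun N : ℕ => (#(outerBoundary (zdGraph d) (box d N)) : ℝ) / #(box d N)) atTop (𝓝 0) := by
  have h0 : Tendsto (fun N : ℕ => 2 * (N : ℝ) + 1) atTop atTop :=
    tendsto_atTop_mono (fun N => by linarith [(Nat.cast_nonneg N : (0 : ℝ) ≤ N)]) tendsto_natCast_atTop_atTop
  have he := tendsto_pow_add_two_sub_pow_div d h0
  refine squeeze_zero (fun N => by positivity) (fun N => ?_) he
  have hcard : (#(box d N) : ℝ) = (2 * (N : ℝ) + 1) ^ d := by rw [card_box]; push_cast; ring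
  have h4 : (#(outerBoundary (zdGraph d) (box d N)) : ℝ) + (2 * (N : ℝ) + 1) ^ d ≤ (2 * (N : ℝ) + 3) ^ d := by
    exact_mod_cast card_outerBoundary_box_add_le d N
  rw [hcard, show (2 * (N : ℝ) + 1 + 2) = 2 * N + 3 by ring]
  exact div_le_div_of_nonneg_right (by linarith) (by positivity)

/-- `|∂ᵉˣΛ_N| m^d / |Λ_N| → 0` for every fixed tile side `m`. [cite: FriedliVelenik2017, Thm. 3.6 (proof), eq. (3.5)] -/
theorem tendsto_card_outerBoundary_box_mul_div (d m : ℕ) :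
    Tendsto (fun N : ℕ => (#(outerBoundary (zdGraph d) (box d N)) : ℝ) * m ^ d / #(box d N)) atTop (𝓝 0) := by
  have h := (tendsto_card_outerBoundary_box_div d).mul_const ((m : ℝ) ^ d)
  rw [zero_mul] at h
  refine h.congr fun N => ?_
  ring

/-- **The covered fraction tends to one**: if `|A_N| m^d ≤ |Λ_N| ≤ |A_N| m^d + |∂ᵉˣΛ_N| m^d` for every `N`, then
`|A_N| m^d / |Λ_N| → 1`. [cite: FriedliVelenik2017, Thm. 3.6 (proof)] -/
theorem tendsto_card_tiles_mul_div {m : ℕ} (K : ℕ → ℕ)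
    (hK : ∀ N, K N * m ^ d ≤ #(box d N) ∧ #(box d N) ≤ K N * m ^ d + #(outerBoundary (zdGraph d) (box d N)) * m ^ d) :
    Tendsto (fun N : ℕ => ((K N : ℝ) * m ^ d) / #(box d N)) atTop (𝓝 1) := by
  have hV : ∀ N, (0 : ℝ) < #(box d N) := fun N => by exact_mod_cast (box_nonempty d N).card_pos
  have hup : ∀ N, ((K N : ℝ) * m ^ d) / #(box d N) ≤ 1 := fun N => by
    rw [div_le_one (hV N)]
    exact_mod_cast (hK N).1
  have hlow : ∀ N, 1 - (#(outerBoundary (zdGraph d) (box d N)) : ℝ) * m ^ d / #(box d N) ≤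
      ((K N : ℝ) * m ^ d) / #(box d N) := fun N => by
    rw [sub_le_iff_le_add, ← add_div, le_div_iff₀ (hV N), one_mul]
    exact_mod_cast (hK N).2
  have h1 : Tendsto (fun N : ℕ => 1 - (#(outerBoundary (zdGraph d) (box d N)) : ℝ) * m ^ d / #(box d N)) atTop
      (𝓝 1) := by
    have := (tendsto_card_outerBoundary_box_mul_div d m).const_sub 1
    rwa [sub_zero] at this
  exact tendsto_of_tendsto_of_tendsto_of_le_of_le h1 tendsto_const_nhds hlow hup

/-- **The number of tiles tends to infinity** (`m ≥ 1`). [cite: FriedliVelenik2017, Thm. 3.6 (proof)] -/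
theorem tendsto_card_tiles_atTop (hd : 1 ≤ d) {m : ℕ} (hm : 0 < m) (K : ℕ → ℕ)
    (hK : ∀ N, K N * m ^ d ≤ #(box d N) ∧ #(box d N) ≤ K N * m ^ d + #(outerBoundary (zdGraph d) (box d N)) * m ^ d) :
    Tendsto (fun N : ℕ => (K N : ℝ)) atTop atTop := by
  have hcard : Tendsto (fun N : ℕ => (#(box d N) : ℝ)) atTop atTop := by
    refine tendsto_atTop_mono (fun N => ?_) tendsto_natCast_atTop_atTop
    have h1 : N ≤ #(box d N) := by
      rw [card_box]
      exact (show N ≤ 2 * N + 1 by omega).trans (Nat.le_self_pow (by omega : d ≠ 0) _)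
    exact_mod_cast h1
  have hmd : (0 : ℝ) < (m : ℝ) ^ d := by positivity
  -- eventually `K_N m^d / |Λ_N| ≥ 1/2`, so `K_N ≥ |Λ_N| / (2 m^d)`
  have hev : ∀ᶠ N : ℕ in atTop, (1 / 2 : ℝ) ≤ ((K N : ℝ) * m ^ d) / #(box d N) :=
    (tendsto_card_tiles_mul_div K hK).eventually (eventually_ge_nhds (by norm_num))
  refine tendsto_atTop_mono' atTop ?_ ((hcard.atTop_div_const (mul_pos two_pos hmd)))
  filter_upwards [hev] with N hN
  have hV : (0 : ℝ) < #(box d N) := by exact_mod_cast (box_nonempty d N).card_pos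
  rw [le_div_iff₀ hV] at hN
  rw [div_le_iff₀ (mul_pos two_pos hmd)]
  linarith

end IsingLargeDeviations

end Summit.CriticalPhenomena.PercolationContinuityZ3.Theorems.FK
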